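import Literature.Probability.RandomPlanarGeometry.ChordalCurveFamily
import HarnessLib

/-!
# The restriction-coupled domain Markov property of a chordal curve family

Topic `Literature/Probability/RandomPlanarGeometry` (definition item
`defn-ChordalFamily.IsRestrictionMarkov`, for crux `Rigidity` / `AxiomsOfLimit` of route
SAWRestrictionRigidity, `stmt-CriticalPhenomena-1368`).

For a chordal curve family `P : ChordalFamily` (a law `P D` on unparametrised planar curves for
every Dobrushin domain `(D; a, b)`, file `ChordalCurveFamily.lean`) the **domain Markov property**
(Werner 2007 §3.2, condition (2): "for any given `t`, the conditional law of `γ[t, ∞)` given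
`γ[0, t]` is `P_{D_t, γ_t, c}`, where `D_t` is the connected component of `D ∖ γ[0, t]` that
contains a neighborhood of `c`") is expressed in the tree through a **Markov kernel**
`Q D past` — the conditional law of the future given the explored initial piece `past` — and the
structure `ChordalFamily.IsMarkovExtension P Q` (`initial`, `markov`, `domain` clauses), because
the slit domains `D_t` are not Jordan domains and so `P_{D_t, γ_t, c}` is not a value of `P`.

This file adds the clause that ties the kernel `Q` back to the family `P` through RESTRICTION:

* `ChordalFamily.IsRestrictionKernel P Q` — for every Dobrushin domain `D`, explored past `p`
  and every Dobrushin (Jordan) domain `D'` contained in the remaining slit domain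
  `remainingDomain D p`, whose first marked point is the tip `p.target` and whose second marked
  point is the target `b = D.pt 1`, and every measurable `T`,
  `P D' (T) · Q D p {γ ⊆ D̄'} = Q D p (T ∩ {γ ⊆ D̄'})`:
  the future, conditioned to stay in `D̄'`, has the family's own law `P D'`. This is exactly what
  Werner's (2) gives after composing with the two-sided restriction property
  (Lawler–Schramm–Werner 2003 §1; `ChordalFamily.IsRestriction`) of the family extended to slit
  domains: `Q D p = P_{D_t, γ_t, b}` and `P_{D_t, γ_t, b}` conditioned on `{γ ⊆ D̄'}` is `P_{D'}`.
  For the critical self-avoiding walk both identities are exact at every mesh: the rest of a SAW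
  after an initial piece is a SAW "in the domain with `γ[0,t]` removed" (LSW 2004 §2.3), and the
  SAW measures "satisfy the restriction property: if `D' ⊂ D`, then `μ_saw(z,w;D',N)` is
  `μ_saw(z,w;D,N)` restricted to walks that stay in `N D'`" (LSW 2004 §3.4.5).
* `ChordalFamily.IsRestrictionMarkov P := ∃ Q, P.IsMarkovExtension Q ∧ P.IsRestrictionKernel Q`
  — the **restriction-coupled domain Markov property**, hypothesis (iii) of `Rigidity` and a
  conjunct of `AxiomsOfLimit` in route SAWRestrictionRigidity (there inlined literally; see
  `ChordalFamily.isRestrictionMarkov_iff`).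

## Why a separate notion (requester's rationale, recorded)

`ChordalFamily.IsDomainMarkov P := ∃ Q, P.IsMarkovExtension Q` alone is (nearly) vacuous on
families carried by simple curves touching `∂D` only at `a, b`: its `domain` clause compares two
configurations `(D₁, p₁)`, `(D₂, p₂)` with equal remaining domain, tip and target, but for such a
past the set `D ∖ p.range` already determines `D` and `p`, so the clause essentially never relates
distinct configurations and any law admits some past-kernel. Content returns once `Q` is tied to
`P`, which is what `IsRestrictionKernel` does.

## API

* `remainingDomain_eq_carrier_of_disjoint`, `remainingDomain_mk_const`: with nothing explored
  (`past` = the constant curve at `a`, or any past missing `D`) the remaining domain is `D`;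
* `ChordalFamily.isRestrictionMarkov_iff` (unfolding, literally the inlined clause);
* `ChordalFamily.IsRestrictionMarkov.isDomainMarkov`;
* `ChordalFamily.IsRestrictionKernel.isRestriction`, `ChordalFamily.IsRestrictionMarkov.isRestriction`:
  taking `p` = the trivial past and `Q D (const a) = P D` (`initial`), the kernel clause IS the
  two-sided restriction property `ChordalFamily.IsRestriction`;
* `ChordalFamily.IsRestrictionKernel.self_mul` (the clause on the sure event `T = {γ ⊆ D̄'}`);
* non-vacuity: `ChordalFamily.tipKernel` ("stay at the tip") is a Markov extension of
  `ChordalFamily.tipFamily` (`isMarkovExtension_tipKernel`) and a restriction kernel for it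
  (`isRestrictionKernel_tipKernel`), whence `isRestrictionMarkov_tipFamily`.

No family with `IsChordal ∧ IsRestrictionMarkov` carried by simple curves is exhibited here: by
Lawler–Schramm–Werner 2003 the conformally covariant ones are the SLE_{8/3}-type laws, and
producing one is the content of the route, not of this definition file.

## Sources

W. Werner, *Lectures on two-dimensional critical percolation*, IAS/Park City Math. Ser. 16 (2009),
arXiv:0710.0856, §3.2 conditions (1)–(3) (p. 19 of the arXiv version: the domain Markov
property); G. Lawler, O. Schramm, W. Werner, *Conformal restriction: the chordal case*, J. Amer.
Math. Soc. 16 (2003) 917–955, §1 (restriction property), §3 (two-sided restriction);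
G. Lawler, O. Schramm, W. Werner, *On the scaling limit of planar self-avoiding walk*, Proc.
Sympos. Pure Math. 72.2 (2004) 339–364, arXiv:math/0204277, §2.3 ("If `γ` is SAW … the rest of
the path is still SAW, in the domain with `γ[0,t]` removed") and §3.4.5 (restriction property of
`μ_saw`); O. Schramm, Israel J. Math. 118 (2000) §1.

## Mathlib / tree

Mathlib has no SLE / random-curve axiomatics (searched `Markov.*[Cc]urve|restriction` under
`Mathlib/Probability`: only `ProbabilityTheory.Kernel.IsReversible`, unrelated). Tree:
`ChordalFamily`, `IsMarkovExtension`, `IsDomainMarkov`, `IsRestriction`, `remainingDomain`,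
`tipFamily` (ChordalCurveFamily.lean); `CurveClass.rangeSubset`, `measurableSet_rangeSubset`
(CurveSpace.lean); `DobrushinDomain`, `MarkedDomain.pt_mem_frontier` (PlanarDomains.lean);
`MarkedDomain.pt_notMem_carrier` exists in BoundaryCorrespondence.lean (not imported: heavy).
-/

noncomputable section

open Set MeasureTheory Topology Filter
open scoped unitInterval ENNReal

namespace Literature.Probability.RandomPlanarGeometry

/-! ### The remaining domain of a trivial past -/

/-- If the explored piece misses `D` (e.g. it is the constant curve at the boundary point `a`),
nothing has been cut out: the remaining domain is all of `D` (`D` is connected and `b ∈ ∂D` lies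
in its closure). [folklore] -/
theorem remainingDomain_eq_carrier_of_disjoint (D : DobrushinDomain) {past : CurveClass ℂ}
    (h : Disjoint D.carrier past.range) : remainingDomain D past = D.carrier := by
  have hdiff : D.carrier \ past.range = D.carrier := h.sdiff_eq_left
  ext z
  simp only [remainingDomain, mem_setOf_eq, hdiff]
  refine ⟨fun hz => hz.1, fun hz => ⟨hz, ?_⟩⟩
  have hcc : connectedComponentIn D.carrier z = D.carrier :=
    (connectedComponentIn_subset _ _).antisymm
      (D.isConnected.isPreconnected.subset_connectedComponentIn hz Subset.rfl)
  rw [hcc]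
  exact frontier_subset_closure (D.pt_mem_frontier 1)

/-- With nothing explored — the past is the constant curve at `a = D.pt 0` — the remaining domain
is `D` itself (so Werner's `P_{D_0, γ_0, c}` is `P_{D, x, c}`): the marked point `a ∈ ∂D` is not
in the open set `D`. (The fact `D.pt i ∉ D.carrier` is `MarkedDomain.pt_notMem_carrier` in
`BoundaryCorrespondence.lean`; re-derived inline to keep the imports of this file minimal.)
[folklore] -/
theorem remainingDomain_mk_const (D : DobrushinDomain) :
    remainingDomain D (CurveClass.mk (Curve.const (D.pt 0))) = D.carrier := by
  refine remainingDomain_eq_carrier_of_disjoint D ?_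
  rw [CurveClass.range_mk, Curve.range_const, disjoint_singleton_right]
  have hf := D.pt_mem_frontier 0
  rw [D.isOpen.frontier_eq] at hf
  exact hf.2

namespace ChordalFamily

/-! ### The restriction-coupled Markov kernel -/

/-- **`Q` is a restriction kernel for `P`**: for every Dobrushin domain `(D; a, b)`, every
explored past `p` (tip `p.target`) and every Dobrushin domain `D'` contained in the remaining slit
domain `remainingDomain D p` with marked points `D'.pt 0 = p.target` (the tip) and
`D'.pt 1 = b`, the conditional law of the future `Q D p`, conditioned on the curve staying in
`closure D'`, is the family's own law `P D'`:
`P D' (T) · Q D p {γ ⊆ D̄'} = Q D p (T ∩ {γ ⊆ D̄'})` for all measurable `T` (product form;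
vacuous where `{γ ⊆ D̄'}` is `Q D p`-null). Werner 2007 §3.2 (2) ("the conditional law of
`γ[t, ∞)` given `γ[0, t]` is `P_{D_t, γ_t, c}`") composed with two-sided restriction from the slit
domain `D_t` to its Jordan subdomains (LSW 2003 §1, §3; exact for the critical SAW in the slit
graph, LSW 2004 §2.3 and §3.4.5). With `p` the trivial past this is `IsRestriction`
(`IsRestrictionKernel.isRestriction`). [cite: Werner2007, §3.2 (2)] -/
def IsRestrictionKernel (P : ChordalFamily)
    (Q : DobrushinDomain → CurveClass ℂ → Measure (CurveClass ℂ)) : Prop :=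
  ∀ (D : DobrushinDomain) (p : CurveClass ℂ) (D' : DobrushinDomain),
    D'.carrier ⊆ remainingDomain D p → D'.pt 0 = p.target → D'.pt 1 = D.pt 1 →
      ∀ T : Set (CurveClass ℂ), MeasurableSet T →
        P D' T * Q D p (CurveClass.rangeSubset (closure D'.carrier)) =
          Q D p (T ∩ CurveClass.rangeSubset (closure D'.carrier))

/-- **Restriction-coupled domain Markov property** of a chordal family on Dobrushin domains:
there is a kernel `Q D past` (law of the future given the explored past) which is a domain-Markov
extension of `P` (`IsMarkovExtension`: `Q D (const a) = P D`, disintegration of `P D` along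
(initial piece, final piece) at the first hitting of every closed set, dependence only on the
remaining marked slit domain) AND a restriction kernel for `P` (`IsRestrictionKernel`: conditioned
to stay in any Dobrushin subdomain `D'` of the remaining slit domain pinned at the tip and at
`b`, the future has law `P D'`). "The future is the same model in the slit domain": Werner 2007
§3.2 (2) for a family indexed by Jordan domains only, coupled to LSW restriction; hypothesis
(iii) of `Rigidity` / conjunct of `AxiomsOfLimit`, route SAWRestrictionRigidity.
[cite: Werner2007, §3.2 (2)] -/
def IsRestrictionMarkov (P : ChordalFamily) : Prop :=
  ∃ Q : DobrushinDomain → CurveClass ℂ → Measure (CurveClass ℂ),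
    P.IsMarkovExtension Q ∧ P.IsRestrictionKernel Q

/-- Unfolding `IsRestrictionMarkov` — literally the clause inlined in route SAWRestrictionRigidity
(`Rigidity`, `AxiomsOfLimit`). [folklore] -/
theorem isRestrictionMarkov_iff (P : ChordalFamily) :
    P.IsRestrictionMarkov ↔
      ∃ Q : DobrushinDomain → CurveClass ℂ → Measure (CurveClass ℂ),
        P.IsMarkovExtension Q ∧
          ∀ (D : DobrushinDomain) (p : CurveClass ℂ) (D' : DobrushinDomain),
            D'.carrier ⊆ remainingDomain D p → D'.pt 0 = p.target → D'.pt 1 = D.pt 1 →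
              ∀ T : Set (CurveClass ℂ), MeasurableSet T →
                P D' T * Q D p (CurveClass.rangeSubset (closure D'.carrier)) =
                  Q D p (T ∩ CurveClass.rangeSubset (closure D'.carrier)) :=
  Iff.rfl

/-- Unfolding `IsRestrictionKernel`. [folklore] -/
theorem isRestrictionKernel_iff (P : ChordalFamily)
    (Q : DobrushinDomain → CurveClass ℂ → Measure (CurveClass ℂ)) :
    P.IsRestrictionKernel Q ↔
      ∀ (D : DobrushinDomain) (p : CurveClass ℂ) (D' : DobrushinDomain),
        D'.carrier ⊆ remainingDomain D p → D'.pt 0 = p.target → D'.pt 1 = D.pt 1 →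
          ∀ T : Set (CurveClass ℂ), MeasurableSet T →
            P D' T * Q D p (CurveClass.rangeSubset (closure D'.carrier)) =
              Q D p (T ∩ CurveClass.rangeSubset (closure D'.carrier)) :=
  Iff.rfl

/-- Constructor: a Markov extension that is also a restriction kernel witnesses
`IsRestrictionMarkov`. [folklore] -/
theorem IsRestrictionMarkov.intro {P : ChordalFamily}
    {Q : DobrushinDomain → CurveClass ℂ → Measure (CurveClass ℂ)}
    (hQ : P.IsMarkovExtension Q) (hR : P.IsRestrictionKernel Q) : P.IsRestrictionMarkov :=
  ⟨Q, hQ, hR⟩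

/-- A restriction-Markov family is domain Markov. [folklore] -/
theorem IsRestrictionMarkov.isDomainMarkov {P : ChordalFamily} (h : P.IsRestrictionMarkov) :
    P.IsDomainMarkov := by
  obtain ⟨Q, hQ, -⟩ := h
  exact ⟨Q, hQ⟩

/-- **The kernel clause at the trivial past is two-sided restriction.** If `Q` is a restriction
kernel for `P` and `Q D (const a) = P D` (the `initial` clause of a Markov extension), then `P`
has the restriction property `IsRestriction`: take `p = const a`, whose remaining domain is `D`
(`remainingDomain_mk_const`) and whose tip is `a`. [cite: LawlerSchrammWerner2003Restriction, §1 p. 4] -/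
theorem IsRestrictionKernel.isRestriction {P : ChordalFamily}
    {Q : DobrushinDomain → CurveClass ℂ → Measure (CurveClass ℂ)}
    (hR : P.IsRestrictionKernel Q)
    (h0 : ∀ D : DobrushinDomain, Q D (CurveClass.mk (Curve.const (D.pt 0))) = P D) :
    P.IsRestriction := by
  intro D D' hsub hpt0 hpt1 T hT
  have h := hR D (CurveClass.mk (Curve.const (D.pt 0))) D'
    (by rwa [remainingDomain_mk_const]) (by simpa [Curve.target_def] using hpt0) hpt1 T hT
  rwa [h0 D] at h

/-- **Restriction-Markov implies restriction** (LSW 2003 two-sided restriction, in the Dobrushin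
form `IsRestriction`): the kernel clause at the trivial past, with `Q D (const a) = P D`.
[cite: LawlerSchrammWerner2003Restriction, §1 p. 4] -/
theorem IsRestrictionMarkov.isRestriction {P : ChordalFamily} (h : P.IsRestrictionMarkov) :
    P.IsRestriction := by
  obtain ⟨Q, hQ, hR⟩ := h
  exact hR.isRestriction hQ.initial

/-- The kernel clause on the sure event `T = {γ ⊆ D̄'}`:
`P D' {γ ⊆ D̄'} · Q D p {γ ⊆ D̄'} = Q D p {γ ⊆ D̄'}`, so `P D'` gives full mass to `{γ ⊆ D̄'}`
whenever `Q D p {γ ⊆ D̄'} ≠ 0, ∞`. [folklore] -/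
theorem IsRestrictionKernel.self_mul {P : ChordalFamily}
    {Q : DobrushinDomain → CurveClass ℂ → Measure (CurveClass ℂ)}
    (hR : P.IsRestrictionKernel Q) {D : DobrushinDomain} {p : CurveClass ℂ} {D' : DobrushinDomain}
    (hsub : D'.carrier ⊆ remainingDomain D p) (h0 : D'.pt 0 = p.target) (h1 : D'.pt 1 = D.pt 1) :
    P D' (CurveClass.rangeSubset (closure D'.carrier)) *
        Q D p (CurveClass.rangeSubset (closure D'.carrier)) =
      Q D p (CurveClass.rangeSubset (closure D'.carrier)) := by
  have := hR D p D' hsub h0 h1 (CurveClass.rangeSubset (closure D'.carrier))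
    (CurveClass.measurableSet_rangeSubset isClosed_closure)
  rwa [Set.inter_self] at this

/-! ### Non-vacuity: the degenerate family "stay at `a`" -/

/-- The kernel "stay at the tip": `Q D past = δ_{const past.target}` — the Markov extension of
`tipFamily`. [folklore] -/
def tipKernel : DobrushinDomain → CurveClass ℂ → Measure (CurveClass ℂ) :=
  fun _ p => Measure.dirac (CurveClass.mk (Curve.const p.target))

/-- Pointwise formula for `tipKernel`. [folklore] -/
@[simp] theorem tipKernel_apply (D : DobrushinDomain) (p : CurveClass ℂ) :
    tipKernel D p = Measure.dirac (CurveClass.mk (Curve.const p.target)) := rfl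

/-- `tipKernel` is a domain-Markov extension of `tipFamily` (the proof of
`isDomainMarkov_tipFamily`, with the kernel made explicit). [folklore] -/
theorem isMarkovExtension_tipKernel : tipFamily.IsMarkovExtension tipKernel := by
  classical
  refine ⟨?_, ?_, ?_⟩
  · intro D
    simp [tipFamily, Curve.target_def]
  · intro D F _ S T _ _
    simp only [tipFamily, tipKernel_apply]
    rw [setLIntegral_dirac, Measure.dirac_apply, Measure.dirac_apply]
    simp only [mem_preimage, CurveClass.stopAt_mk_const, CurveClass.target_mk, Curve.target_def,
      Curve.const_apply]
    by_cases hS : CurveClass.mk (Curve.const (D.pt 0)) ∈ S <;>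
      by_cases hT : CurveClass.mk (Curve.const (D.pt 0)) ∈ T <;>
      simp [indicator, hS, hT]
  · intro D₁ D₂ p₁ p₂ _ h _
    rw [tipKernel_apply, tipKernel_apply, h]

/-- `tipKernel` is a restriction kernel for `tipFamily`: with `D'.pt 0 = p.target` both sides are
the Dirac mass at the constant curve at the tip, which stays in every `D̄'`. [folklore] -/
theorem isRestrictionKernel_tipKernel : tipFamily.IsRestrictionKernel tipKernel := by
  intro D p D' _ h0 _ T hT
  have hmem : CurveClass.mk (Curve.const (D'.pt 0)) ∈
      CurveClass.rangeSubset (closure D'.carrier) := by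
    rw [CurveClass.mk_mem_rangeSubset]
    intro t
    rw [Curve.const_apply]
    exact frontier_subset_closure (D'.pt_mem_frontier 0)
  simp only [tipFamily, tipKernel_apply, ← h0]
  rw [Measure.dirac_apply_of_mem hmem, mul_one, Measure.dirac_apply' _ hT,
    Measure.dirac_apply' _ (hT.inter (CurveClass.measurableSet_rangeSubset isClosed_closure))]
  by_cases hTm : CurveClass.mk (Curve.const (D'.pt 0)) ∈ T
  · rw [indicator_of_mem hTm, indicator_of_mem (Set.mem_inter hTm hmem)]
  · rw [indicator_of_notMem hTm, indicator_of_notMem fun h => hTm h.1]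

/-- **Non-vacuity.** `tipFamily` has the restriction-coupled domain Markov property (with kernel
`tipKernel`). [folklore] -/
theorem isRestrictionMarkov_tipFamily : tipFamily.IsRestrictionMarkov :=
  IsRestrictionMarkov.intro isMarkovExtension_tipKernel isRestrictionKernel_tipKernel

end ChordalFamily

end Literature.Probability.RandomPlanarGeometry
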